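import Summits.Ventures.Crystal3D.Theses.StickyWulffConstant
import Summits.Ventures.Crystal3D.Theorems.StickyWulffConstantWulffUpperBoundPeel
import Summits.Ventures.Crystal3D.Theorems.StickyWulffConstantWulffUpperBoundCluster

/-!
# The crux `WulffUpperBound` of route `StickyWulffConstant` (stmt-Ventures-19147), PROVED:
`6N − C(N) ≤ (∛432 + ε) N^{2/3}` eventually, by generic top-peeling of truncated octahedra

HONEST FRAMING. Part of the venture `Summits/Ventures/Crystal3D` (cell `crystal3d-full`, crux seat
`crystal3d-wulff-p1`; line `WulffPeel` of planner p1 g9, spec HOME/cf-p1/route/spec/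
SPEC-WulffUpperBound.md). CONSTRUCTION SIDE ONLY: for every `ε > 0`, eventually
`6N − maxContacts 3 N ≤ (6·2^{1/3} + ε)·N^{2/3}` (`6·2^{1/3} = ∛432 = 7.5595…`, the fcc Wulff
constant in contact-deficiency units; in print as Cicalese–Kreutz–Leonardi 2023, Prop. 2.4 with
(25) — here proved directly, unconditionally, without the named fact). The proof composes the two
registered stubs of the skeleton, both landed as tree theorems:
* `stub_cluster` (`StickyWulffConstantWulffUpperBoundCluster.lean`): for `n ≥ 1` the truncated
  octahedron `TO_n ⊂ D₃` has `≥ 16 n³` points and twice-lattice-deficiency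
  `12|TO_n| − ∑_δ shiftCount TO_n δ ≤ 2·(48n² + 30n + 6)`;
* `stub_peel` (`StickyWulffConstantWulffUpperBoundPeel.lean`): any finite `S ⊂ ℤ³` peels to any
  smaller cardinality without raising that quantity (the top point along `u = (1,10,100)` has at
  most six lattice neighbours);
through the `D₃`-piece packing `d3Config` of `StickySpheres/D3Pieces.lean` (`peeledFamily`: every
`N ≤ |TO_n|` is realised by a unit packing with `6N − C ≤ 48n² + 30n + 6`) and the ε-assembly
`wulffUpperBound_proof` (`a = 2^{1/3}`, `s = N^{1/3}`, `n := ⌊s/(2a)⌋ + 1`, `12/a² = 6a`,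
`N₀ = ⌈(147/ε + 1)³⌉`). Standard axioms only.
WHAT THIS IS NOT: no lower bound / liminf (the cruxes `NoReconstructionGain`, `StackingLiminf`,
`LiminfAssembly` stay open), nothing about ground-state geometry or the Crystallization conjunct;
rung F-C1 is not moved by this crux alone.
-/

noncomputable section

namespace Summit.Ventures.Crystal3D.Theorems

open Summit.Ventures.Crystal3D Finset
open Summit.Ventures.Crystal3D.Theses.StickyWulffConstant
open scoped BigOperators

/-- The PEELED FAMILY (composition of the two stubs through the `D₃`-piece packing `d3Config`):
for every `n ≥ 1` some `M ≥ 16 n³` such that every `N ≤ M` is realised by a unit packing of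
deficiency `6N − C ≤ 48 n² + 30 n + 6`. -/
theorem peeledFamily :
    ∀ n : ℕ, 1 ≤ n → ∃ M : ℕ, 16 * n ^ 3 ≤ M ∧
      ∀ N : ℕ, N ≤ M → 6 * (N : ℝ) - (maxContacts 3 N : ℝ) ≤ 48 * (n : ℝ) ^ 2 + 30 * n + 6 := by
  intro n hn
  obtain ⟨S, hpar, hcard, hdefS⟩ := stub_cluster n hn
  refine ⟨S.card, hcard, fun N hN => ?_⟩
  obtain ⟨T, hTS, hTcard, hTdef⟩ := stub_peel S N hN
  have hparT : ∀ v ∈ T, ∀ w ∈ T, (2 : ℤ) ∣ v 0 + v 1 + v 2 - (w 0 + w 1 + w 2) :=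
    fun v hv w hw => hpar v (hTS hv) w (hTS hw)
  have hpack : IsUnitPacking (d3Config T) := isUnitPacking_d3Config hparT
  have h2 : ∑ δ ∈ d3Offsets, shiftCount T δ ≤ 2 * numContacts (d3Config T) :=
    sum_shiftCount_le_two_mul_numContacts
  have hmax : numContacts (d3Config T) ≤ maxContacts 3 T.card := numContacts_le_maxContacts hpack
  subst hTcard
  have hLT : ((12 * (T.card : ℤ) - ∑ δ ∈ d3Offsets, (shiftCount T δ : ℤ) : ℤ) : ℝ) ≤
      ((2 * (48 * (n : ℤ) ^ 2 + 30 * n + 6) : ℤ) : ℝ) := by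
    exact_mod_cast hTdef.trans hdefS
  have h2' : ((∑ δ ∈ d3Offsets, shiftCount T δ : ℕ) : ℝ) ≤ 2 * (numContacts (d3Config T) : ℝ) := by
    exact_mod_cast h2
  have hmax' : (numContacts (d3Config T) : ℝ) ≤ (maxContacts 3 T.card : ℝ) := by
    exact_mod_cast hmax
  push_cast at hLT h2' ⊢
  linarith

/-- The ε-ASSEMBLY: the peeled family gives the route crux `WulffUpperBound` (by name). With
`a = 2^{1/3}`, `s = N^{1/3}`, `n := ⌊s/(2a)⌋ + 1` one has `N ≤ 16 n³` and
`48 n² + 30 n + 6 ≤ (6a + ε) s²` as soon as `s ≥ 147/ε + 1` (`12/a² = 6a`). -/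
theorem wulffUpperBound_proof : WulffUpperBound := by
  unfold WulffUpperBound
  intro ε hε
  set a : ℝ := (2 : ℝ) ^ ((1 : ℝ) / 3) with ha_def
  have ha_pos : 0 < a := Real.rpow_pos_of_pos (by norm_num) _
  have ha3 : a ^ 3 = 2 := by
    rw [ha_def, ← Real.rpow_natCast, ← Real.rpow_mul (by norm_num : (0 : ℝ) ≤ 2)]
    norm_num
  have ha1 : 1 ≤ a := by
    by_contra hlt
    push Not at hlt
    have : a ^ 3 < 1 := pow_lt_one₀ ha_pos.le hlt (by norm_num)
    linarith
  obtain ⟨K, hK⟩ := exists_nat_ge ((147 / ε + 1) ^ 3)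
  refine ⟨K, fun N hN => ?_⟩
  set s : ℝ := (N : ℝ) ^ ((1 : ℝ) / 3) with hs_def
  have hN0 : (0 : ℝ) ≤ N := Nat.cast_nonneg N
  have hs_nonneg : 0 ≤ s := Real.rpow_nonneg hN0 _
  have hs3 : s ^ 3 = N := by
    rw [hs_def, ← Real.rpow_natCast, ← Real.rpow_mul hN0]
    norm_num
  have hs2 : (N : ℝ) ^ ((2 : ℝ) / 3) = s ^ 2 := by
    rw [hs_def, ← Real.rpow_natCast, ← Real.rpow_mul hN0]
    norm_num
  have hb_pos : 0 < 147 / ε + 1 := by positivity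
  have hs_ge : 147 / ε + 1 ≤ s := by
    have h1 : (147 / ε + 1) ^ 3 ≤ s ^ 3 := by
      rw [hs3]
      exact le_trans hK (by exact_mod_cast hN)
    by_contra hlt
    push Not at hlt
    have : s ^ 3 < (147 / ε + 1) ^ 3 := pow_lt_pow_left₀ hlt hs_nonneg (by norm_num)
    linarith
  have hs1 : 1 ≤ s := by
    have : 0 < 147 / ε := by positivity
    linarith
  have h2a_pos : 0 < 2 * a := by linarith
  set n : ℕ := ⌊s / (2 * a)⌋₊ + 1 with hn_def
  have hn1 : 1 ≤ n := by omega
  have hn_gt : s / (2 * a) < n := by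
    rw [hn_def]; push_cast; exact Nat.lt_floor_add_one _
  have hn_le : (n : ℝ) ≤ s / (2 * a) + 1 := by
    rw [hn_def]; push_cast
    linarith [Nat.floor_le (show 0 ≤ s / (2 * a) by positivity)]
  have h16 : (N : ℝ) ≤ 16 * (n : ℝ) ^ 3 := by
    have hlt : s < n * (2 * a) := (div_lt_iff₀ h2a_pos).mp hn_gt
    have hn0 : (0 : ℝ) ≤ n * (2 * a) := by positivity
    calc (N : ℝ) = s ^ 3 := hs3.symm
      _ ≤ (n * (2 * a)) ^ 3 := pow_le_pow_left₀ hs_nonneg hlt.le 3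
      _ = 8 * a ^ 3 * n ^ 3 := by ring
      _ = 16 * n ^ 3 := by rw [ha3]; ring
  have h16nat : N ≤ 16 * n ^ 3 := by exact_mod_cast h16
  obtain ⟨M, hM, hdef⟩ := peeledFamily n hn1
  have hd := hdef N (le_trans h16nat hM)
  rw [hs2]
  have e1 : 12 / a ^ 2 = 6 * a := by
    rw [div_eq_iff (pow_ne_zero 2 ha_pos.ne')]
    linear_combination (-6 : ℝ) * ha3
  have e2 : 63 / a * s ≤ 63 * s := by
    have : 63 / a ≤ 63 := by
      rw [div_le_iff₀ ha_pos]
      nlinarith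
    exact mul_le_mul_of_nonneg_right this hs_nonneg
  have e3 : 147 * s ≤ ε * s ^ 2 := by
    have h' : 147 / ε ≤ s := by linarith
    have h'' : 147 ≤ s * ε := (div_le_iff₀ hε).mp h'
    nlinarith [mul_le_mul_of_nonneg_left h'' hs_nonneg]
  have hsq : (n : ℝ) ^ 2 ≤ (s / (2 * a) + 1) ^ 2 :=
    pow_le_pow_left₀ (Nat.cast_nonneg n) hn_le 2
  have key : 48 * (n : ℝ) ^ 2 + 30 * n + 6 ≤ (6 * a + ε) * s ^ 2 :=
    calc 48 * (n : ℝ) ^ 2 + 30 * n + 6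
        ≤ 48 * (s / (2 * a) + 1) ^ 2 + 30 * (s / (2 * a) + 1) + 6 := by nlinarith [hsq, hn_le]
      _ = 12 / a ^ 2 * s ^ 2 + 63 / a * s + 84 := by field_simp; ring
      _ = 6 * a * s ^ 2 + 63 / a * s + 84 := by rw [e1]
      _ ≤ 6 * a * s ^ 2 + 147 * s := by linarith [e2, hs1]
      _ ≤ (6 * a + ε) * s ^ 2 := by nlinarith [e3]
  exact le_trans hd key

end Summit.Ventures.Crystal3D.Theorems

end
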